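import Summits.BirchSwinnertonDyer.Rank1Residual.GaloisImage.ThreeCongruenceHesseCertificateLemmas
import Literature.NumberTheory.EllipticCurves.Fisher2012.HesseFamilyThreeReverseProofs
import Summits.BirchSwinnertonDyer.Rank1Residual.Additive.IntModelTamagawaCertificate
import Summits.BirchSwinnertonDyer.BirchSwinnertonDyer.Theorems.Rank2ObservatoryKernelCerts1670
import Summits.BirchSwinnertonDyer.Rank1Residual.Additive.X4ThreeVisibleNskRowShapesP1
import Summits.BirchSwinnertonDyer.BirchSwinnertonDyer.Theorems.Rank2ObservatoryKernelCertsR424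
import HarnessLib

/-!
# Record shapes with the C-VIS `θ/hθ` column AND the rank column DISCHARGED IN THE KERNEL — `T-NSK-REC records (p04 lineage): 39105c1 63054f1`
# (cell `b2b-bsdres`, team n1011, ROW T-VIS3-TH; seat p07 lineage; skeleton cells/n1011/skel/T-VIS3-TH.md;
# generated by `tools/gen_twins2.py` from the TREE text of the records — consumed BY NAME, nothing edited)

HONEST FRAMING (cell `b2b-bsdres`, run/shared/lean/b2b/bsd-rank1-residual/, verbatim in every
file): the goal of the cell is to DELETE the COMBINATION-SHAPED residual classes of the
Birch–Swinnerton-Dyer formula for ALL analytic-rank `≤ 1` elliptic curves over `ℚ` — "full BSD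
formula for every rank `≤ 1` curve in class `C`" assembled STRICTLY from published theorems — so
that the rank-`≤ 1` remainder becomes exactly the CONSTRUCTION-SHAPED classes, which are TYPED
(missing-input `Prop`s), NOT attempted. This is not "finishing BSD". Team n1011 (N11 = X4 ∧ `p = 3`):
research route; RECORD theorems only — NO definition, NO new named fact, NO `sorry`; a record closes
NO class and moves no mark / label / count; nothing booked; census count unchanged.

## What

For each record `R` below (a tree theorem displaying the C-VIS EVIDENCE columns
`(W') (hW' : W' = E′) [W'.IsElliptic] (θ : E′[3] ≃+ E[3]) (hθ : Γ_ℚ-equivariant) (hrank : 2 ≤ rank E′(ℚ))`),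
the twin `RHesse` := `R` with those binders DISCHARGED: θ/hθ by the `n = 3` Hesse-pencil certificate of
Fisher 2012 Thm. 13.2 (DIRECT = `X_E(3)`, or DUAL = `X_E⁻(3)` — unconditional, A243 is the tree theorem
`Fisher2012.thm132rev_threeCongruent_dualHessePencil_holds`), either the tree certificate theorem BY NAME or
ONE call of `VisCerts.torsionIso3_of_hesseCert_mk` / `…_of_dualHesseCert_mk`
(`GaloisImage/ThreeCongruenceHesseCertificateLemmas.lean`) with the certificate `(l : m)`, `u` and ten
`norm_num` identities; hrank by the bsd-rank2-observatory KERNEL certificate of `E′` BY NAME. Every other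
binder is the record's own, token for token.

| record | twin | partner | θ certificate | rank certificate |
|---|---|---|---|---|
| `bsdp3_visN_v39105c1` | `bsdp3_visNHesse_v39105c1` | 54747n1 | direct | percurve |
| `bsdp3_visN_v63054f1` | `bsdp3_visNHesse_v63054f1` | 31527c1 | direct | percurve |

References: [Fisher2012Hessian] T. Fisher, The Hessian of a genus one curve, Proc. LMS 104 (2012),
Thm. 13.2 / §13; [CremonaMazur2000] §3; [CremonaAlgorithms1997] §3.5; [SilvermanAEC2009] VIII.6.7.
-/

set_option autoImplicit false

noncomputable section

open scoped Classical NumberField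
open IsDedekindDomain NumberField WeierstrassCurve Rat.HeightOneSpectrum
  Literature.NumberTheory.EllipticCurves Literature.NumberTheory.EllipticCurves.ModularForms
  Literature.NumberTheory.EllipticCurves.Rank1Residual
  Literature.NumberTheory.EllipticCurves.Rank1Residual.Typed
  Literature.NumberTheory.EllipticCurves.Fisher2012
  Literature.NumberTheory.GaloisRepresentations
  Summit.BirchSwinnertonDyer.BirchSwinnertonDyer.Rank1Residual.IntModel
  Summit.BirchSwinnertonDyer.BirchSwinnertonDyer.Rank1Residual.X11RankOne
  Summit.BirchSwinnertonDyer.BirchSwinnertonDyer.Rank2Observatory.Tam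
  Summit.BirchSwinnertonDyer.BirchSwinnertonDyer.Rank2Observatory
  Summit.BirchSwinnertonDyer.Rank1Residual.GaloisImage

namespace Summit.BirchSwinnertonDyer.Rank1Residual.Additive

/-- **`bsdp3_visN_v39105c1`** (`Additive/X4ThreeVisibleNskRowShapesP1.lean`) with θ/hθ AND hrank
DISCHARGED IN THE KERNEL — partner `54747n1`: θ by inline DIRECT Hesse certificate `(l : m) = (237 :
1)`, `u = 4860`; rank by `KernelCerts1670.C54747n1.two_le_rank`. Other binders verbatim; closes
nothing beyond them; nothing booked.
[cite: Fisher2012Hessian, Thm. 13.2 (n = 3)] [cite: CremonaAlgorithms1997, §3.5] -/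
theorem bsdp3_visNHesse_v39105c1
    (hKatoS : Kato2004.rankZero_padicValNat_sha_le_sub_localTamagawa_of_additive_potGood_of_imageContainsSL2)
    (hDel : Delbourgo1998.prop4_rankZero_pow_dvd_constantCoeff)
    (hGZK : rank_eq_analyticRank_of_analyticRank_le_one) (hmod : hasEntireLFunction_rat)
    (hmodD : nonempty_modularParametrizationData)
    (hKatoχ : Wuthrich2014.kato_halfEigenCharIdeal_dvd_cyclotomicPrime_of_surjective)
    (hCT : exists_casselsTate_pairing (K := ℚ))
    (hU : Silverman1994_thmV53_tateUniformisation.{0})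
    (hU2 : Silverman1994_thmV53_corV54_tateUniformisation.{0})
    (W : WeierstrassCurve ℚ) [W.IsElliptic] [W.IsGloballyMinimal]
    (hI : integralModelInt W = ⟨1, -1, 0, -40050, 1285375⟩)
    (hr : W.analyticRank = 0)
    {q : ℚ} (hq : shaAn W = (q : ℂ)) (hv : padicValRat 3 q ≤ 2) :
    haveI : Fact (Nat.Prime 3) := ⟨Nat.prime_three⟩
    BSDp W 3 := by
  haveI : (⟨0, 0, 1, 645, 994⟩ : WeierstrassCurve ℚ).IsElliptic :=
    ⟨by rw [isUnit_iff_ne_zero]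
        norm_num [WeierstrassCurve.Δ, WeierstrassCurve.b₂, WeierstrassCurve.b₄, WeierstrassCurve.b₆,
          WeierstrassCurve.b₈]⟩
  have hWlit : W = ⟨1, -1, 0, -40050, 1285375⟩ := by
    rw [IntModelTam.eq_baseChange_of_integralModelInt hI]; exact IntModelTam.baseChange_rat_mk_int _ _ _ _ _
  obtain ⟨θ, hθ⟩ := VisCerts.torsionIso3_of_hesseCert_mk
    (W' := (⟨0, 0, 1, 645, 994⟩ : WeierstrassCurve ℚ)) hWlit rfl
    1922409 (-1101913173) (-30960) (-859032) (by norm_num) (by norm_num) (by norm_num) (by norm_num)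
    237 1 4860 (by norm_num) (by norm_num) (by norm_num)
  have hE' : (⟨0, 0, 1, 645, 994⟩ : WeierstrassCurve ℤ).map (Int.castRingHom ℚ) =
      (⟨0, 0, 1, 645, 994⟩ : WeierstrassCurve ℚ) := by
    ext <;> simp [WeierstrassCurve.map]
  have hrank : 2 ≤ (⟨0, 0, 1, 645, 994⟩ : WeierstrassCurve ℚ).mordellWeilRank := by
    rw [← hE']; exact KernelCerts1670.C54747n1.two_le_rank
  exact bsdp3_visN_v39105c1 hKatoS hDel hGZK hmod hmodD hKatoχ hCT hU hU2 W hI hr hq hv _ rfl θ hθ hrank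

/-- **`bsdp3_visN_v63054f1`** (`Additive/X4ThreeVisibleNskRowShapesP1.lean`) with θ/hθ AND hrank
DISCHARGED IN THE KERNEL — partner `31527c1`: θ by inline DIRECT Hesse certificate `(l : m) =
(-15171 : 1)`, `u = 147456`; rank by `KernelCertsR424.C31527c1.two_le_rank`. Other binders verbatim;
closes nothing beyond them; nothing booked.
[cite: Fisher2012Hessian, Thm. 13.2 (n = 3)] [cite: CremonaAlgorithms1997, §3.5] -/
theorem bsdp3_visNHesse_v63054f1
    (hKatoS : Kato2004.rankZero_padicValNat_sha_le_sub_localTamagawa_of_additive_potGood_of_imageContainsSL2)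
    (hDel : Delbourgo1998.prop4_rankZero_pow_dvd_constantCoeff)
    (hGZK : rank_eq_analyticRank_of_analyticRank_le_one) (hmod : hasEntireLFunction_rat)
    (hmodD : nonempty_modularParametrizationData)
    (hKatoχ : Wuthrich2014.kato_halfEigenCharIdeal_dvd_cyclotomicPrime_of_surjective)
    (hCT : exists_casselsTate_pairing (K := ℚ))
    (hU : Silverman1994_thmV53_tateUniformisation.{0})
    (hU2 : Silverman1994_thmV53_corV54_tateUniformisation.{0})
    (W : WeierstrassCurve ℚ) [W.IsElliptic] [W.IsGloballyMinimal]
    (hI : integralModelInt W = ⟨1, -1, 0, -2435688, -1058023616⟩)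
    (hr : W.analyticRank = 0)
    {q : ℚ} (hq : shaAn W = (q : ℂ)) (hv : padicValRat 3 q ≤ 2) :
    haveI : Fact (Nat.Prime 3) := ⟨Nat.prime_three⟩
    BSDp W 3 := by
  haveI : (⟨0, 0, 1, -192, 1264⟩ : WeierstrassCurve ℚ).IsElliptic :=
    ⟨by rw [isUnit_iff_ne_zero]
        norm_num [WeierstrassCurve.Δ, WeierstrassCurve.b₂, WeierstrassCurve.b₄, WeierstrassCurve.b₆,
          WeierstrassCurve.b₈]⟩
  have hWlit : W = ⟨1, -1, 0, -2435688, -1058023616⟩ := by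
    rw [IntModelTam.eq_baseChange_of_integralModelInt hI]; exact IntModelTam.baseChange_rat_mk_int _ _ _ _ _
  obtain ⟨θ, hθ⟩ := VisCerts.torsionIso3_of_hesseCert_mk
    (W' := (⟨0, 0, 1, -192, 1264⟩ : WeierstrassCurve ℚ)) hWlit rfl
    116913033 914658512859 9216 (-1092312) (by norm_num) (by norm_num) (by norm_num) (by norm_num)
    (-15171) 1 147456 (by norm_num) (by norm_num) (by norm_num)
  have hE' : (⟨0, 0, 1, -192, 1264⟩ : WeierstrassCurve ℤ).map (Int.castRingHom ℚ) =
      (⟨0, 0, 1, -192, 1264⟩ : WeierstrassCurve ℚ) := by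
    ext <;> simp [WeierstrassCurve.map]
  have hrank : 2 ≤ (⟨0, 0, 1, -192, 1264⟩ : WeierstrassCurve ℚ).mordellWeilRank := by
    rw [← hE']; exact KernelCertsR424.C31527c1.two_le_rank
  exact bsdp3_visN_v63054f1 hKatoS hDel hGZK hmod hmodD hKatoχ hCT hU hU2 W hI hr hq hv _ rfl θ hθ hrank

end Summit.BirchSwinnertonDyer.Rank1Residual.Additive

end
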